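import Literature.Analysis.FluidPDE.LuoTitiIteration
import Literature.Barriers.NavierStokesRegularity.LionsExponentSharpnessIterationProofs
import HarnessLib

/-!
# Discharges of named facts of `LionsExponentSharpnessProofs.lean`

`Literature/Barriers/NavierStokesRegularity/LionsExponentSharpnessProofsHolds.lean` —
proofs-only sibling of `LionsExponentSharpnessProofs.lean` (no definitions, no named facts).
Each theorem below closes a named fact `X : Prop` of that file as `X_holds : X` by composing
an ACCEPTED reduction theorem of the tree with the ACCEPTED unconditional `_holds` discharges
of all of its hypotheses; nothing is re-proved and no statement is changed. Recorded by the
librarian sweep g25 (2026-08-16, pass 5c: facts dischargeable in one line from the tree's own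
lemmas), so that the facts census, `#h21_route_deps` and the cone guardrail see these facts as
theorems.

Discharged here:

* `LuoTiti2020_thm1_holds` := `LuoTiti2020_thm1_of_iterationLemma`
  `LuoTiti2020_iterationLemma_holds` (`LionsExponentSharpnessIterationProofs.lean`).

## References

* [LuoTiti2020] — see `lean/references.bib` and the docstring of the fact in `LionsExponentSharpnessProofs.lean`.
-/

namespace Literature.Barriers.NavierStokesRegularity

/-- **Discharge of the named fact `LuoTiti2020_thm1`** (`LionsExponentSharpnessProofs.lean`):
Luo–Titi 2020, Theorem 1, main clause (as printed, §1): "Assume that `θ ∈ [1, 5/4)`. Suppose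
`u` is a smooth divergence-free vector field, define[d] on `ℝ₊ × 𝕋³`, with compact support in
time and satisfies the condition `∫_{𝕋³} u(t,x) dx ≡ 0`. … — obtained as
`LuoTiti2020_thm1_of_iterationLemma` applied to the tree's unconditional discharge
`LuoTiti2020_iterationLemma_holds` of its hypothesis (reduction in
`LionsExponentSharpnessIterationProofs.lean`).
[cite: LuoTiti2020, §1 Theorem 1 (main clause); proof §2] -/
theorem LuoTiti2020_thm1_holds :
    LuoTiti2020_thm1 :=
  LuoTiti2020_thm1_of_iterationLemma
    Literature.Analysis.FluidPDE.Torus.LuoTiti2020_iterationLemma_holds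

end Literature.Barriers.NavierStokesRegularity
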